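import Mathlib.MeasureTheory.Measure.Lebesgue.Basic
import Mathlib.Topology.Order.DenselyOrdered
import Mathlib.Topology.Connected.Basic
import HarnessLib

/-!
# The Kontsevich–Zagier conjecture in dimension `≤ 1`, VIIa: gaps of a finite set of reals

Elementary real-line combinatorics for the partition of a one-dimensional semialgebraic domain:
the GAPS of a finite set `E ⊆ ℝ` (pairs of consecutive points), the fact that a point strictly
between two points of `E` and not in `E` lies in a gap, that distinct gaps have null (at most
one-point) closed overlap, and that an open interval containing no boundary point of a set `A`
is contained in `A` or disjoint from it (connectedness).
-/

noncomputable section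

open MeasureTheory Set

namespace Summit.KontsevichZagierPeriods.KontsevichZagierPeriods.Theorems

namespace SoloBlind

/-- `(c, c')` is a gap of the finite set `E`: consecutive points of `E`. -/
def IsGap (E : Finset ℝ) (c c' : ℝ) : Prop :=
  c ∈ E ∧ c' ∈ E ∧ c < c' ∧ ∀ e ∈ E, e ∉ Ioo c c'

/-- A point outside `E` but strictly between two points of `E` lies in a gap of `E`. -/
theorem exists_isGap_mem (E : Finset ℝ) {t : ℝ} (ht : t ∉ E) (hlo : ∃ e ∈ E, e < t)
    (hhi : ∃ e ∈ E, t < e) : ∃ c c', IsGap E c c' ∧ t ∈ Ioo c c' := by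
  classical
  obtain ⟨e₁, he₁, he₁t⟩ := hlo
  obtain ⟨e₂, he₂, hte₂⟩ := hhi
  set L := E.filter (fun e => e < t) with hL
  set U := E.filter (fun e => t < e) with hU
  have hLne : L.Nonempty := ⟨e₁, Finset.mem_filter.2 ⟨he₁, he₁t⟩⟩
  have hUne : U.Nonempty := ⟨e₂, Finset.mem_filter.2 ⟨he₂, hte₂⟩⟩
  have hcL := Finset.max'_mem L hLne
  have hcU := Finset.min'_mem U hUne
  rw [Finset.mem_filter] at hcL hcU
  refine ⟨L.max' hLne, U.min' hUne, ⟨hcL.1, hcU.1, hcL.2.trans hcU.2, fun e he heI => ?_⟩,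
    hcL.2, hcU.2⟩
  rcases lt_trichotomy e t with h | h | h
  · exact (not_lt.2 (Finset.le_max' L e (Finset.mem_filter.2 ⟨he, h⟩))) heI.1
  · exact ht (h ▸ he)
  · exact (not_lt.2 (Finset.min'_le U e (Finset.mem_filter.2 ⟨he, h⟩))) heI.2

/-- Distinct gaps have closed intervals meeting in at most one point, hence in a null set. -/
theorem volume_Icc_inter_Icc_of_isGap {E : Finset ℝ} {c₁ c₁' c₂ c₂' : ℝ} (h₁ : IsGap E c₁ c₁')
    (h₂ : IsGap E c₂ c₂') (hne : (c₁, c₁') ≠ (c₂, c₂')) :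
    volume (Icc c₁ c₁' ∩ Icc c₂ c₂') = 0 := by
  obtain ⟨hc₁, hc₁', hlt₁, hE₁⟩ := h₁
  obtain ⟨hc₂, hc₂', hlt₂, hE₂⟩ := h₂
  rcases lt_trichotomy c₁ c₂ with h | h | h
  · -- `c₁ < c₂`: then `c₁' ≤ c₂`, the overlap is inside `{c₂}`
    have h' : c₁' ≤ c₂ := not_lt.1 fun hlt => hE₁ c₂ hc₂ ⟨h, hlt⟩
    refine measure_mono_null (fun x hx => ?_) (measure_singleton c₂)
    exact le_antisymm (hx.1.2.trans h') hx.2.1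
  · subst h
    have : c₁' = c₂' := by
      by_contra hne'
      rcases lt_or_gt_of_ne hne' with hlt | hlt
      · exact hE₂ c₁' hc₁' ⟨hlt₁, hlt⟩
      · exact hE₁ c₂' hc₂' ⟨hlt₂, hlt⟩
    exact absurd (Prod.ext rfl this : (c₁, c₁') = (c₁, c₂')) hne
  · have h' : c₂' ≤ c₁ := not_lt.1 fun hlt => hE₂ c₁ hc₁ ⟨h, hlt⟩
    refine measure_mono_null (fun x hx => ?_) (measure_singleton c₁)
    exact le_antisymm (hx.2.2.trans h') hx.1.1

/-- An open interval without boundary points of `A` is contained in `A` or disjoint from `A`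
(connectedness of the interval). -/
theorem Ioo_subset_or_disjoint_of_frontier {A : Set ℝ} {c c' : ℝ}
    (h : ∀ x ∈ Ioo c c', x ∉ frontier A) : Ioo c c' ⊆ A ∨ Disjoint (Ioo c c') A := by
  have hcover : Ioo c c' ⊆ interior A ∪ interior Aᶜ := by
    intro x hx
    by_cases hxi : x ∈ interior A
    · exact Or.inl hxi
    · right
      rw [interior_compl]
      intro hxc
      exact h x hx ⟨hxc, hxi⟩
  have hdisj : Disjoint (interior A) (interior Aᶜ) :=
    disjoint_compl_right.mono interior_subset interior_subset
  rcases isPreconnected_Ioo.subset_or_subset isOpen_interior isOpen_interior hdisj hcover with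
    h1 | h1
  · exact Or.inl (h1.trans interior_subset)
  · exact Or.inr (Set.disjoint_left.2 fun x hx hxA => interior_subset (h1 hx) hxA)

/-- A point of a finite set lies outside it only if ... (helper): membership in the frontier of
`A` propagates along an interval free of frontier points — if such an interval meets `A` it is
contained in `A`. -/
theorem Ioo_subset_of_frontier_of_mem {A : Set ℝ} {c c' t : ℝ}
    (h : ∀ x ∈ Ioo c c', x ∉ frontier A) (ht : t ∈ Ioo c c') (htA : t ∈ A) : Ioo c c' ⊆ A := by
  rcases Ioo_subset_or_disjoint_of_frontier h with h1 | h1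
  · exact h1
  · exact absurd htA (Set.disjoint_left.1 h1 ht)

end SoloBlind

end Summit.KontsevichZagierPeriods.KontsevichZagierPeriods.Theorems
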